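import Mathlib
import HarnessLib
import Summits.Ventures.LatticeQCDFlow.Exactness.LazyRelaxationLagLaw

/-!
# GeneralLayerDissipation — the mean dissipated work of the stepwise linear protocol with ARBITRARY
# relaxation layers, and THE LAG-LAW IDENTITY `⟨W⟩ − ΔF = KL_qs + Σ_j (c_{j+1} − c_j)·lag_j`

HONEST FRAMING: exact (Metropolis-corrected) sampling algorithms for lattice gauge theory;
figures of merit are autocorrelation/cost numbers at stated couplings and volumes; no
continuum-physics claim.

Venture `LatticeQCDFlow` (cell pub-lqcd), topic `Scaling`; FANOUT row 19 (`su2-snf`; written GEN-5 as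
the first section of `Scaling/GeneralLayerLagLaw`, split out GEN-9 so that the identity — which needs
nothing but row 8's finite framework `Exactness/LazyRelaxationLagLaw` — is available to BOTH lag laws:
the `χ²` route (`Scaling/GeneralLayerLagLaw`, contraction coefficient `ρ`, change-of-reference factor
`e^{ΔD/(2n)}`) and the relative-entropy route (`Scaling/EntropyLagLaw`, entropy contraction `κ`,
NO sup-norm factor)).  OUR WORK (elementary finite sums); nothing is cited as a fact.

Setting (row 8): finite configuration space, linear protocol `S_c = S₀ + c • D` along a grid
`c_0, …, c_n`, started in equilibrium at `c_0`; after the switch `c_k → c_{k+1}` (work increment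
`(c_{k+1} − c_k)·D`) a relaxation layer `P_k` with unit row sums, targeting `π_{c_{k+1}}`, acts;
`μ_j = evolveLaw P π_{c_0} j` is the `j`-th marginal.

* `layerDissipation S₀ D c P n` — `⟨W⟩ − ΔF` with general layers (`= lazyDissipation` for lazy
  layers, `lazyDissipation_eq_layerDissipation`, `rfl`; `= D(P_F ‖ P_R)` for positive stochastic
  layers, `kl_path_layer_eq`);
* `layerLag S₀ D c P j = E_{μ_j}[D] − ⟨D⟩_{c_j}` (signed);
* **`layerDissipation_eq`** — for any layers with unit row sums:
  `⟨W⟩ − ΔF = KL_qs + Σ_{j<n} (c_{j+1} − c_j)·layerLag_j` (`KL_qs = qsDissipation`, row 8).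

NOT CLAIMED: any bound — the two lag laws bound `layerLag_j` by `χ²` (Cauchy–Schwarz) resp. by
relative entropy (Donsker–Varadhan).
-/

namespace Summit.Ventures.LatticeQCDFlow.Scaling

open Finset
open Literature.Probability.MarkovChains (IsRowStochastic stepLaw)
open Summit.Ventures.LatticeQCDFlow.Exactness
open Summit.Ventures.LatticeQCDFlow.Theory2

variable {X : Type*} [Fintype X]

/-! ## Mean dissipated work with general layers; the lag-law identity -/

/-- `⟨W⟩ − ΔF`: the mean dissipated work of the `n`-step linear protocol `S_{c_k} = S₀ + c_k • D`
started in equilibrium at `c 0`, with the layer `P k` (unit row sums, targeting `π_{c_{k+1}}`) after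
the switch `c_k → c_{k+1}`. -/
noncomputable def layerDissipation (S₀ D : X → ℝ) (c : ℕ → ℝ) (P : ℕ → X → X → ℝ) (n : ℕ) : ℝ :=
  (∑ ω : Fin (n + 1) → X,
      pathLaw (gibbsLaw (linAction S₀ D (c 0))) (fun k : Fin n => P k) ω
      * work (fun k : Fin (n + 1) => linAction S₀ D (c k)) ω)
    - (linFreeEnergy S₀ D (c n) - linFreeEnergy S₀ D (c 0))

/-- The LAG of the switch observable at step `j`: `E_{μ_j}[D] − ⟨D⟩_{c_j}` (`μ_j` the `j`-th
marginal `evolveLaw`; signed in general). -/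
noncomputable def layerLag (S₀ D : X → ℝ) (c : ℕ → ℝ) (P : ℕ → X → X → ℝ) (j : ℕ) : ℝ :=
  ∑ y, evolveLaw P (gibbsLaw (linAction S₀ D (c 0))) j y * D y - meanD S₀ D (c j)

/-- Row 8's `lazyDissipation` is `layerDissipation` with lazy layers (definitionally). -/
theorem lazyDissipation_eq_layerDissipation [DecidableEq X] (S₀ D : X → ℝ) (c : ℕ → ℝ) (ε : ℝ)
    (n : ℕ) :
    lazyDissipation S₀ D c ε n
      = layerDissipation S₀ D c (fun k => lazyLayer (gibbsLaw (linAction S₀ D (c (k + 1)))) ε) n :=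
  rfl

/-- **THE LAG-LAW IDENTITY for any layers with unit row sums**:
`⟨W⟩ − ΔF = KL_qs + Σ_{j<n} (c_{j+1} − c_j)·(E_{μ_j}[D] − ⟨D⟩_{c_j})`. -/
theorem layerDissipation_eq [Nonempty X] (S₀ D : X → ℝ) (c : ℕ → ℝ) (P : ℕ → X → X → ℝ)
    (hP : ∀ k x, ∑ y, P k x y = 1) (n : ℕ) :
    layerDissipation S₀ D c P n
      = qsDissipation S₀ D c n + ∑ j ∈ range n, (c (j + 1) - c j) * layerLag S₀ D c P j := by
  have h := meanWork_eq_sum_evolveLaw n (gibbsLaw (linAction S₀ D (c 0)))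
    (fun k => linAction S₀ D (c k)) P hP
  beta_reduce at h
  have tel : ∑ j ∈ range n, (linFreeEnergy S₀ D (c (j + 1)) - linFreeEnergy S₀ D (c j))
      = linFreeEnergy S₀ D (c n) - linFreeEnergy S₀ D (c 0) :=
    Finset.sum_range_sub (fun j => linFreeEnergy S₀ D (c j)) n
  have hstep : ∀ j, ∑ y, evolveLaw P (gibbsLaw (linAction S₀ D (c 0))) j y
        * (linAction S₀ D (c (j + 1)) y - linAction S₀ D (c j) y)
      = (c (j + 1) - c j) * (meanD S₀ D (c j) + layerLag S₀ D c P j) := by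
    intro j
    unfold layerLag
    rw [add_sub_cancel, mul_sum]
    refine sum_congr rfl fun y _ => ?_
    simp only [linAction]
    ring
  unfold layerDissipation qsDissipation
  rw [h, ← tel, ← sum_sub_distrib, ← sum_add_distrib]
  refine sum_congr rfl fun j _ => ?_
  rw [hstep j]
  ring

/-- For positive stochastic layers `layerDissipation` IS the forward path relative entropy
`D(P_F ‖ P_R)` of the protocol (`kl_path_eq_dissipation`), the printed `D̃_KL`. -/
theorem kl_path_layer_eq [Nonempty X] (S₀ D : X → ℝ) (c : ℕ → ℝ) (P : ℕ → X → X → ℝ)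
    (hP : ∀ k, IsRowStochastic (P k)) (hPpos : ∀ k x y, 0 < P k x y) (n : ℕ) :
    klFin (pathLaw (gibbsLaw (linAction S₀ D (c 0))) (fun k : Fin n => P k))
        (revPathLaw (fun k : Fin (n + 1) => linAction S₀ D (c k)) (fun k : Fin n => P k))
      = layerDissipation S₀ D c P n := by
  have h := kl_path_eq_dissipation (fun k : Fin (n + 1) => linAction S₀ D (c k))
    (fun k : Fin n => P k) (fun k => hP k) (fun k x y => hPpos k x y)
  simp only [Fin.val_zero, Fin.val_last] at h
  rw [h]
  unfold layerDissipation linFreeEnergy freeEnergy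
  rw [Real.log_div (partitionFn_pos _).ne' (partitionFn_pos _).ne']
  ring

end Summit.Ventures.LatticeQCDFlow.Scaling
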